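import Summits.BirchSwinnertonDyer.Rank1Residual.ManinAdditive.MinusOneLevelRaisingGeneralProof
import HarnessLib

/-!
# THE GENERAL `χ₋₄` ROTATION LAW — PART B5c: the general DEGREE law `deg′·ψ(N) = deg·ψ(N′)` on a `χ₋₄`-orbit and
# E-an-148D `MinusOneLevelRaisingByTwoDegree` (`deg′ = 2·deg` on `8 ∥ N ⇝ 2N`) PROVED (cell bsd-f2-manin, -an g32, MEMO-an §75.10)

TYPER NOTE (typer g17, TURNKEY-an-25, PART B5c = 3/3).  §10 `DegreeGeneral` of an's HOME/an/g32/MinusOneLevelRaisingGeneralProof.lean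
57aa2c9e76daaa63 VERBATIM (see PART B5a for the header and the split rationale), minus the `dedup.landed` re-derivation
`minusOneLevelRaisingDegree_holds'`.  ONE new `def … : Prop`: **E-an-148D `MinusOneLevelRaisingByTwoDegree`**, immediately
PROVED (`minusOneLevelRaisingByTwoDegree_holds`).  THEOREMS: `modularDegree_eq_mul_of_orbit_general` (if `W′ = u • (W ⊗ (−1))`,
`c′ = ±c`, `4 ∣ N(W)`, `4 ∣ N(W′)`, `ψ(N(W′)) = m·ψ(N(W))` then `deg φ′ = m·deg φ`: Zagier at both levels, Connell–Pal
`covol′ = covol`, cross-level Petersson comparison of B2), `modularDegree_eq_of_sameLevel_orbit` (THEOREM I's regime: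
`deg φ′ = deg φ`).  Census (an, gen_rotation_check.out): `deg′·N = deg·N′` on every in-range pair, zero failures.
BSD is not proved by this; Manin's conjecture is not proved by this; C2/C3 OPEN.
[cite: ZagierCMB1985, §1 (p. 374)] [cite: Rankin1939, Thm. 3]
-/

set_option autoImplicit false

noncomputable section

open scoped MatrixGroups ModularForm
open CongruenceSubgroup WeierstrassCurve
  Literature.NumberTheory.DiophantineGeometry
  Literature.NumberTheory.EllipticCurves
  Literature.NumberTheory.EllipticCurves.ModularForms
  Summit.BirchSwinnertonDyer.BirchSwinnertonDyer.Theorems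

namespace Summit.BirchSwinnertonDyer.Rank1Residual.ManinAdditive

section DegreeGeneral

/-! ## §10 THE GENERAL DEGREE LAW `deg′·ψ(N) = deg·ψ(N′)` on a `χ₋₄`-orbit, and E-an-148D `deg′ = 2·deg` (8 ∥ N ⇝ 2N)

Zagier at both levels, `covol′ = covol` (Connell–Pal, `u² = 1`), `c′² = c²`, and the cross-level Petersson comparison of §5
with `ψ(N′) = m·ψ(N)`.  Census (in-range pairs, `deg′·N = deg·N′`): (3,4) 85 778/85 778, every pattern zero failures. -/

/-- **General degree law on a `χ₋₄`-orbit of optimal curves**: if `W′ = u • (W ⊗ (−1))`, `c′ = ±c`, `4 ∣ N(W)`, `4 ∣ N(W′)`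
and `ψ(N(W′)) = m·ψ(N(W))`, then `deg φ′ = m·deg φ`. -/
theorem modularDegree_eq_mul_of_orbit_general {W W' : WeierstrassCurve ℚ}
    [W.IsElliptic] [W.IsGloballyMinimal] [W'.IsElliptic] [W'.IsGloballyMinimal]
    [NeZero (W.conductorNorm ℤ)] [NeZero (W'.conductorNorm ℤ)]
    (D : ModularParametrizationData W (W.conductorNorm ℤ))
    (D' : ModularParametrizationData W' (W'.conductorNorm ℤ))
    (u : VariableChange ℚ) (hu : u • W.quadraticTwist ((-1 : ℤ) : ℚ) = W')
    (hc : D'.c = D.c ∨ D'.c = -D.c) (h4 : 2 ^ 2 ∣ W.conductorNorm ℤ) (h4' : 2 ^ 2 ∣ W'.conductorNorm ℤ)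
    (m : ℕ) (hψm : gamma0Index (W'.conductorNorm ℤ) = m * gamma0Index (W.conductorNorm ℤ)) :
    D'.modularDegree = m * D.modularDegree := by
  haveI : Fact (Nat.Prime 2) := ⟨Nat.prime_two⟩
  have hd0 : ((-1 : ℤ) : ℚ) ≠ 0 := by norm_num
  -- (1) `|aₙ(W′)| = |aₙ(W)|`, hence `‖aₙ(f′)‖ = ‖aₙ(f)‖`
  obtain ⟨hngW, hnmW⟩ := not_good_and_not_mult_of_sq_dvd_conductorNorm W h4
  obtain ⟨hngW', hnmW'⟩ := not_good_and_not_mult_of_sq_dvd_conductorNorm W' h4'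
  have hW0 : ∀ n : ℕ, 2 ∣ n → W.LFunction n = 0 := fun n hn ↦
    W.LFunction_apply_eq_zero_of_not_good_of_not_mult 2 hngW hnmW hn
  have hW'0 : ∀ n : ℕ, 2 ∣ n → W'.LFunction n = 0 := fun n hn ↦
    W'.LFunction_apply_eq_zero_of_not_good_of_not_mult 2 hngW' hnmW' hn
  have habs : ∀ n : ℕ, (W'.LFunction n).natAbs = (W.LFunction n).natAbs :=
    natAbs_LFunction_eq_of_twist_even hd0 u hu (fun n ↦ ZMod.χ₄ n) natAbs_χ₄_of_odd
      (LFunction_quadraticTwist_negOne_intCast_of_odd W) hW0 hW'0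
  have hcoef : ∀ n : ℕ, ‖cuspCoeff D'.f n‖ = ‖cuspCoeff D.f n‖ := by
    intro n
    rw [D'.isNewformOf.2 n, D.isNewformOf.2 n, Complex.norm_intCast, Complex.norm_intCast]
    have key := congrArg (fun m : ℕ ↦ (m : ℝ)) (habs n)
    simp only [Nat.cast_natAbs, Int.cast_abs] at key
    exact key
  -- (2) Petersson norms across the two levels: `Re(f′,f′)_{N′} = m Re(f,f)_N`
  have hψ := gamma0Index_mul_re_peterssonProduct_eq_of_norm_cuspCoeff_eq D.f D'.f hcoef
  have hψ4 : (gamma0Index (W'.conductorNorm ℤ) : ℝ) = (m : ℝ) * gamma0Index (W.conductorNorm ℤ) := by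
    rw [hψm]; push_cast; ring
  have hψ0 : (gamma0Index (W.conductorNorm ℤ) : ℝ) ≠ 0 := by
    exact_mod_cast (gamma0Index_pos (W.conductorNorm ℤ)).ne'
  have hP : (peterssonProduct (Gamma0 (W'.conductorNorm ℤ)) 2 D'.f D'.f).re =
      (m : ℝ) * (peterssonProduct (Gamma0 (W.conductorNorm ℤ)) 2 D.f D.f).re := by
    rw [hψ4] at hψ
    have h0 : (gamma0Index (W.conductorNorm ℤ) : ℝ) *
        ((peterssonProduct (Gamma0 (W'.conductorNorm ℤ)) 2 D'.f D'.f).re -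
          (m : ℝ) * (peterssonProduct (Gamma0 (W.conductorNorm ℤ)) 2 D.f D.f).re) = 0 := by
      linear_combination hψ
    rcases mul_eq_zero.mp h0 with h | h
    · exact absurd h hψ0
    · linarith
  -- (3) covolumes: `covol(Λ_{W′}) = covol(Λ_W)`
  have hΔ : W'.Δ = W.Δ := negOneTwistMinimalDiscrEq_holds W W' u h4 h4' hu
  have hΔ' : W'.Δ = ((-1 : ℤ) : ℚ) ^ 6 * W.Δ := by rw [hΔ]; norm_num
  have hu2 : ((u.u : ℚ)) ^ 2 = 1 := u_sq_eq_one_of_smul_quadraticTwist_of_Δ hd0 u hu hΔ'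
  set T := W.quadraticTwist ((-1 : ℤ) : ℚ) with hT
  haveI : T.IsElliptic := W.isElliptic_quadraticTwist hd0
  have hd0C : ((((-1 : ℤ) : ℚ)) : ℂ) ≠ 0 := by exact_mod_cast hd0
  have h4c : (T.baseChange ℂ).c₄ = ((((-1 : ℤ) : ℚ)) : ℂ) ^ 2 * (W.baseChange ℂ).c₄ := by
    simp only [hT, WeierstrassCurve.baseChange, WeierstrassCurve.map_c₄,
      WeierstrassCurve.quadraticTwist_c₄, map_mul, map_pow, eq_ratCast]
  have h6c : (T.baseChange ℂ).c₆ = ((((-1 : ℤ) : ℚ)) : ℂ) ^ 3 * (W.baseChange ℂ).c₆ := by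
    simp only [hT, WeierstrassCurve.baseChange, WeierstrassCurve.map_c₆,
      WeierstrassCurve.quadraticTwist_c₆, map_mul, map_pow, eq_ratCast]
  obtain ⟨LT, hLT⟩ : ∃ LT : PeriodPair, IsNeronLatticeOf (T.baseChange ℂ) LT :=
    exists_isNeronLatticeOf_holds (T.baseChange ℂ)
  have hcovT : ZLattice.covolume LT.lattice = ZLattice.covolume D.L.lattice := by
    rw [IsNeronLatticeOf.covolume_eq_div_of_c₄_eq_of_c₆_eq hd0C h4c h6c D.isNeronLattice hLT]
    norm_num
  have hD'L : IsNeronLatticeOf ((u • T).baseChange ℂ) D'.L := by rw [hu]; exact D'.isNeronLattice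
  have hcov' : ZLattice.covolume D'.L.lattice = ZLattice.covolume D.L.lattice := by
    rw [IsNeronLatticeOf.lattice_eq_mulLeft_of_smul u hLT hD'L, PeriodPair.covolume_mulLeft_lattice,
      hcovT]
    have hn : ‖((u.u : ℚ) : ℂ)‖ ^ 2 = 1 := by
      rw [show (((u.u : ℚ) : ℂ)) = ((((u.u : ℚ) : ℝ)) : ℂ) by norm_cast, Complex.norm_real,
        Real.norm_eq_abs, sq_abs]
      exact_mod_cast hu2
    rw [hn, one_mul]
  -- (4) Zagier's formula for both data
  have hZ := D.deg_mul_covolume_eq_re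
  have hZ' := D'.deg_mul_covolume_eq_re
  have hc2 : (D'.c : ℝ) ^ 2 = (D.c : ℝ) ^ 2 := by
    rcases hc with h | h
    · rw [h]
    · rw [h]; push_cast; ring
  rw [hcov', hP, hc2] at hZ'
  have hcov0 : ZLattice.covolume D.L.lattice ≠ 0 := (ZLattice.covolume_pos _ _).ne'
  have key : (D'.deg : ℝ) * ZLattice.covolume D.L.lattice =
      ((m * D.deg : ℕ) : ℝ) * ZLattice.covolume D.L.lattice := by
    rw [hZ']
    push_cast
    linear_combination (-(m : ℝ)) * hZ
  have hdeg : (D'.deg : ℝ) = ((m * D.deg : ℕ) : ℝ) := mul_right_cancel₀ hcov0 key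
  simp only [ModularParametrizationData.modularDegree]
  exact_mod_cast hdeg

/-- **Candidate E-an-148D `MinusOneLevelRaisingByTwoDegree`**: on the `8 ∣ N ⇝ 2N` orbit with lattice-optimal data,
`deg φ′ = 2·deg φ` (`[Γ₀(N) : Γ₀(2N)] = 2`). -/
def MinusOneLevelRaisingByTwoDegree : Prop :=
  ∀ (W W' : WeierstrassCurve ℚ) [W.IsElliptic] [W'.IsElliptic] [W.IsGloballyMinimal]
    [W'.IsGloballyMinimal] [NeZero (W.conductorNorm ℤ)] [NeZero (W'.conductorNorm ℤ)]
    (D : ModularParametrizationData W (W.conductorNorm ℤ))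
    (D' : ModularParametrizationData W' (W'.conductorNorm ℤ)),
    IsLatticeOptimal D → IsLatticeOptimal D' →
    2 ^ 3 ∣ W.conductorNorm ℤ → W'.conductorNorm ℤ = 2 * W.conductorNorm ℤ →
    IsIsogenous (W.quadraticTwist ((-1 : ℤ) : ℚ)) W' → D'.modularDegree = 2 * D.modularDegree

/-- **E-an-148D is a THEOREM.** -/
theorem minusOneLevelRaisingByTwoDegree_holds : MinusOneLevelRaisingByTwoDegree := by
  intro W W' _ _ _ _ _ _ D D' hD hD' h8 hN hiso
  obtain ⟨⟨u, hu⟩, hc⟩ := minusOneLevelRaisingByTwoOptimalOrbit_holds W W' D D' hD hD' h8 hN hiso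
  have h4 : 2 ^ 2 ∣ W.conductorNorm ℤ := dvd_trans ⟨2, by norm_num⟩ h8
  have h4' : 2 ^ 2 ∣ W'.conductorNorm ℤ := by rw [hN]; exact dvd_mul_of_dvd_right h4 2
  have hN0 : W.conductorNorm ℤ ≠ 0 := NeZero.ne _
  have h2N : 2 ∣ W.conductorNorm ℤ := dvd_trans ⟨2, by norm_num⟩ h4
  exact modularDegree_eq_mul_of_orbit_general D D' u hu hc h4 h4' 2
    (by rw [hN]; exact gamma0Index_mul_of_prime_dvd Nat.prime_two hN0 h2N)

-- (typer g17: an's `minusOneLevelRaisingDegree_holds'` — E-an-145D re-derived with `m = 4` — is omitted: same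
-- statement as the landed `minusOneLevelRaisingDegree_holds` (B2 p694844), `dedup.landed`.)

/-- THEOREM I's regime (same conductor, `16 ∣ N`, lattice-optimal data): `deg φ′ = deg φ`. -/
theorem modularDegree_eq_of_sameLevel_orbit {W W' : WeierstrassCurve ℚ}
    [W.IsElliptic] [W.IsGloballyMinimal] [W'.IsElliptic] [W'.IsGloballyMinimal]
    [NeZero (W.conductorNorm ℤ)] [NeZero (W'.conductorNorm ℤ)]
    (D : ModularParametrizationData W (W.conductorNorm ℤ))
    (D' : ModularParametrizationData W' (W'.conductorNorm ℤ))
    (hD : IsLatticeOptimal D) (hD' : IsLatticeOptimal D')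
    (h16 : 2 ^ 4 ∣ W.conductorNorm ℤ) (hN : W'.conductorNorm ℤ = W.conductorNorm ℤ)
    (hiso : IsIsogenous (W.quadraticTwist ((-1 : ℤ) : ℚ)) W') :
    D'.modularDegree = D.modularDegree := by
  have h4 : 2 ^ 2 ∣ W.conductorNorm ℤ := dvd_trans ⟨4, by norm_num⟩ h16
  obtain ⟨⟨u, hu⟩, hc⟩ := minusOneTwistOptimalOrbit_general D D' hD hD' h4
    (by rw [hN]; simpa using h16) (by rw [hN]) (by rw [hN]; exact Dvd.intro_left 4 rfl) hiso
  have h := modularDegree_eq_mul_of_orbit_general D D' u hu hc h4 (by rw [hN]; exact h4) 1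
    (by rw [hN, one_mul])
  simpa using h

end DegreeGeneral

end Summit.BirchSwinnertonDyer.Rank1Residual.ManinAdditive

end
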